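import Summits.BirchSwinnertonDyer.BirchSwinnertonDyer.Theorems.PrintCFramBottomClassIndexLawFiveLeFlipRungTwoGaussSums
import HarnessLib

/-!
# Crux `PrintCFram.BottomClassIndexLawFiveLe` (stmt-BirchSwinnertonDyer-20372), line `eisenstein-resource-bdp-line` (registry v29 `stub_flipRungs.2`):
# THE 2-ADIC FLIPPED-CUSP RUNG, piece P1b — THE MULTIPLIERS `μ_j` ARE A PATTERN, AND THE WEIGHTS ARE T6a's TABLES
# (cell `bsd-print-cfram`, width seat `bsd-line-cfram-p1-w7` g8; THEOREMS ONLY, `--supports` 20372 `--as helper`; BSD is not proved by any of this)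

HONEST FRAMING. Finite identities in `ℂ`; nothing about BSD; no registered stub is closed. P1 (`…FlipRungTwoFlipIdentity`,
`hasSum_oddPart_flippedCusp_of_det`) reads the odd part of a translate average at the flipped cusp with coefficients
`√(8(M′w+1))^K·(Σ_{j∈{1,3,5,7}} ω(j)·μ_j·e(−jn/8))·b(n)`, `μ_j = ψ(d_j)·(ε_{d_j}⁻¹·J(8M′ | d_j))^K`, `d_j = 8 + M′j`, `K = 2k+1`. Here, for the
trivial character (`ψ(d_j) = 1`, the case of every vehicle of this line):

* §1 `multiplierPow_eq_pattern` — `(ε_{d_j}⁻¹ J(8M′|d_j))^{2k+1} = J(2|M′)·Φ₀(M′j mod 8)` with the EXPLICIT pattern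
  `Φ₀(r) = [r ≡ 3 (4) ? σ : 1]·J(2|r)·ε_r⁻¹`, `σ = (−1)^k·(−1)^{[M′ ≡ 3 (4)]}` (T6a `jacobiSym_eight_mul_left`, `thetaEps_inv_pow_two_mul_add_one`,
  `jacobiTwo_mul_thetaEps_inv_mod_eight`; `d_j ≡ 8 (mod M′)`, `d_j ≡ M′j (mod 8)`).
* §2 `flipWeightSum_multiplier` — hence `Σ_{j} (ε⁻¹J)^{2k+1}_j · z^{(8 − tj % 8) % 8} = J(2|M′)·T(M′t mod 8)` with `T` = T6a's table `dft8_pattern_one`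
  (`σ = 1`: `±4z⁷` at `M′t ≡ 1, 5`) resp. `dft8_pattern_chi4` (`σ = −1`: `∓4z` at `M′t ≡ 3, 7`), `0` otherwise — for ANY `z` with `z² = i`.
* §3 `classWeight_mul_translatePhase` — the bookkeeping `(ζ₈^{cj})⁻¹·e(−jn/8) = ζ₈^{(8 − (c+n)j % 8) % 8}` joining Tunnell's `classProj` weights
  `ζ₈^{−cj}/8` and P1's phases `e(−jn/8)` into the exponent `t = c + n` of §2.
So the coefficient of `e(nw)` in the odd part of `(P_c g)` at the flipped cusp is `√(8(M′w+1))^{2k+1}·(J(2|M′)/8)·T(M′(c+n) mod 8)·b(n)`: a UNIT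
(`|T| = 4`) exactly on the classes `M′(c+n) ≡ 1, 5` resp. `3, 7 (mod 8)`, i.e. `n + c ≡ 2k+1 (mod 4)` (crux notes w7g8-T6 §1d(i), §5c).

No definitions, no named facts, no `sorry`. beyond-print theorem: NO.
References: [Shimura1973HalfIntegral] §1 (1.10); crux notes w7g8-T6 §1d, §3b, §5.
-/

set_option autoImplicit false
-- summit-side namespace `Summit.BirchSwinnertonDyer.BirchSwinnertonDyer.…` (single-conjunct summit, D-0017 layout)
set_option linter.dupNamespace false

noncomputable section

open Complex
open scoped NumberTheorySymbols Real
open Literature.NumberTheory.EllipticCurves.ModularForms (thetaEps)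
open Literature.NumberTheory.EllipticCurves (Tunnell1983.int_gcd_two_eq_one)

namespace Summit.BirchSwinnertonDyer.BirchSwinnertonDyer.Theorems.PrintCFram.FlipRung

/-! ## §1 The multiplier `(ε_{d_j}⁻¹ J(8M′|d_j))^{2k+1}` is `J(2|M′)` times a pattern of `d_j mod 8 = M′j mod 8` -/

/-- `x^{2k+1} = x` when `x² = 1`. [folklore] -/
theorem pow_two_mul_add_one_of_sq_eq_one {R : Type*} [Monoid R] {x : R} (h : x ^ 2 = 1) (k : ℕ) : x ^ (2 * k + 1) = x := by
  rw [pow_succ, pow_mul, h, one_pow, one_mul]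

/-- `J(8M′ | d)² = 1` for odd `M′`, odd `d ≡ 8 (mod M′)`. [cite: IrelandRosen1990, Prop. 5.2.2] -/
theorem jacobiSym_eight_mul_sq {M d : ℕ} (hM : Odd M) (hd : Odd d) (hdM : (d : ℤ) % M = 8 % M) : J(8 * M | d) ^ 2 = 1 := by
  rw [jacobiSym_eight_mul_left hM hd hdM]
  rcases jacobiSym.eq_one_or_neg_one (Tunnell1983.int_gcd_two_eq_one hM) with h1 | h1 <;>
    rcases jacobiSym.eq_one_or_neg_one (Tunnell1983.int_gcd_two_eq_one hd) with h2 | h2 <;>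
      rw [h1, h2] <;> split_ifs <;> norm_num

/-- **THE MULTIPLIER IS A PATTERN OF `M′j mod 8`.** For odd `M′`, `j`, `d_j = 8 + M′j`, `k : ℕ`:
`(ε_{d_j}⁻¹·J(8M′|d_j))^{2k+1} = J(2|M′)·[M′j mod 8 ≡ 3 (4) ? (−1)^k(−1)^{[M′≡3(4)]} : 1]·J(2 | M′j mod 8)·ε_{M′j mod 8}⁻¹`.
[cite: Shimura1973HalfIntegral, §1 (1.10)] -/
theorem multiplierPow_eq_pattern {M : ℕ} (hM : Odd M) (k : ℕ) {j : ℕ} (hj : Odd j) :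
    ((thetaEps ((8 + M * j : ℕ) : ℤ))⁻¹ * (J(8 * M | (8 + M * j : ℕ)) : ℂ)) ^ (2 * k + 1) =
      (J(2 | M) : ℂ) * ((if M * j % 8 % 4 = 3 then (-1 : ℂ) ^ k * (if M % 4 = 3 then -1 else 1) else 1) *
        ((J(2 | (M * j % 8 : ℕ)) : ℂ) * (thetaEps ((M * j % 8 : ℕ) : ℤ))⁻¹)) := by
  obtain ⟨hdM, hd8, hdodd⟩ := flipRung_dj_congr M j hM hj
  have hJ := jacobiSym_eight_mul_left hM hdodd hdM
  have hsq : ((J(8 * M | (8 + M * j : ℕ)) : ℂ)) ^ 2 = 1 := by exact_mod_cast jacobiSym_eight_mul_sq hM hdodd hdM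
  have hε := thetaEps_inv_pow_two_mul_add_one ((8 + M * j : ℕ) : ℤ) k
  have hpat := jacobiTwo_mul_thetaEps_inv_mod_eight hdodd
  rw [hd8] at hpat
  have h4 : (((8 + M * j : ℕ) : ℤ) % 4 = 3) ↔ M * j % 8 % 4 = 3 := by omega
  have h4' : ((8 + M * j) % 4 = 3) ↔ M * j % 8 % 4 = 3 := by omega
  rw [mul_pow, pow_two_mul_add_one_of_sq_eq_one hsq, hε, hJ]
  simp only [Int.cast_mul, Int.cast_ite, Int.cast_neg, Int.cast_one]
  by_cases hr : M * j % 8 % 4 = 3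
  · rw [if_pos (h4.mpr hr), if_pos hr]
    by_cases hM3 : M % 4 = 3
    · rw [if_pos ⟨hM3, h4'.mpr hr⟩, if_pos hM3]
      linear_combination (-((-1 : ℂ) ^ k) * (J(2 | M) : ℂ)) * hpat
    · rw [if_neg (fun h => hM3 h.1), if_neg hM3]
      linear_combination ((-1 : ℂ) ^ k * (J(2 | M) : ℂ)) * hpat
  · rw [if_neg (fun h => hr (h4.mp h)), if_neg hr, if_neg (fun h => hr (h4'.mp h.2))]
    linear_combination ((J(2 | M) : ℂ)) * hpat

/-! ## §2 The weight sums are T6a's tables -/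

/-- The sign `σ = (−1)^k(−1)^{[M′≡3(4)]}` is `±1`. [folklore] -/
theorem sign_eq_one_or {M k : ℕ} :
    (-1 : ℂ) ^ k * (if M % 4 = 3 then -1 else 1) = 1 ∨ (-1 : ℂ) ^ k * (if M % 4 = 3 then -1 else 1) = -1 := by
  rcases Nat.even_or_odd k with h | h
  · rw [h.neg_one_pow]; split_ifs <;> norm_num
  · rw [h.neg_one_pow]; split_ifs <;> norm_num

/-- **THE WEIGHTS OF THE 2-ADIC FLIPPED-CUSP RUNG (trivial character).** For odd `M′`, `k`, any `z` with `z² = i` and `t : ℕ`: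
`Σ_{j∈{1,3,5,7}} (ε_{d_j}⁻¹J(8M′|d_j))^{2k+1}·z^{(8 − tj % 8) % 8} = J(2|M′)·T`, where for `σ = (−1)^k(−1)^{[M′≡3(4)]} = 1`:
`T = 4z⁷ / −4z⁷ / 0` as `M′t ≡ 1 / 5 / else (mod 8)`, and for `σ = −1`: `T = −4z / 4z / 0` as `M′t ≡ 3 / 7 / else`.
[cite: Shimura1973HalfIntegral, §1 (1.10), Prop. 1.5] -/
theorem flipWeightSum_multiplier {M : ℕ} (hM : Odd M) (k : ℕ) {z : ℂ} (hz : z ^ 2 = I) (t : ℕ) :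
    ∑ j ∈ ({1, 3, 5, 7} : Finset ℕ),
        ((thetaEps ((8 + M * j : ℕ) : ℤ))⁻¹ * (J(8 * M | (8 + M * j : ℕ)) : ℂ)) ^ (2 * k + 1) * z ^ ((8 - t * j % 8) % 8) =
      (J(2 | M) : ℂ) *
        (if (-1 : ℂ) ^ k * (if M % 4 = 3 then -1 else 1) = 1 then
          (if M * t % 8 = 1 then 4 * z ^ 7 else if M * t % 8 = 5 then -4 * z ^ 7 else 0)
        else (if M * t % 8 = 3 then -4 * z else if M * t % 8 = 7 then 4 * z else 0)) := by
  -- rewrite every summand through the pattern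
  have hsum : ∑ j ∈ ({1, 3, 5, 7} : Finset ℕ),
      ((thetaEps ((8 + M * j : ℕ) : ℤ))⁻¹ * (J(8 * M | (8 + M * j : ℕ)) : ℂ)) ^ (2 * k + 1) * z ^ ((8 - t * j % 8) % 8) =
      (J(2 | M) : ℂ) * ∑ j ∈ ({1, 3, 5, 7} : Finset ℕ),
        (fun r : ℕ => (if r % 4 = 3 then (-1 : ℂ) ^ k * (if M % 4 = 3 then -1 else 1) else 1) *
          ((J(2 | r) : ℂ) * (thetaEps (r : ℤ))⁻¹)) (M * j % 8) * z ^ ((8 - t * j % 8) % 8) := by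
    rw [Finset.mul_sum]
    refine Finset.sum_congr rfl (fun j hj => ?_)
    have hjodd : Odd j := by
      simp only [Finset.mem_insert, Finset.mem_singleton] at hj
      rcases hj with rfl | rfl | rfl | rfl <;> decide
    rw [multiplierPow_eq_pattern hM k hjodd]
    ring
  obtain ⟨e1, e3, e5, e7⟩ := thetaEps_values
  rw [hsum]
  rcases sign_eq_one_or (M := M) (k := k) with h1 | h1
  · rw [h1, if_pos rfl]
    congr 1
    exact flipWeightSum_pattern_one hM
      (fun r : ℕ => (if r % 4 = 3 then (1 : ℂ) else 1) * ((J(2 | r) : ℂ) * (thetaEps (r : ℤ))⁻¹))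
      ⟨by norm_num [e1], by norm_num [e3], by norm_num [e5], by norm_num [e7]⟩ hz t
  · rw [h1, if_neg (by norm_num)]
    congr 1
    exact flipWeightSum_pattern_chi4 hM
      (fun r : ℕ => (if r % 4 = 3 then (-1 : ℂ) else 1) * ((J(2 | r) : ℂ) * (thetaEps (r : ℤ))⁻¹))
      ⟨by norm_num [e1], by norm_num [e3], by norm_num [e5], by norm_num [e7]⟩ hz t

/-! ## §3 Joining the class weights `ζ₈^{−cj}/8` and the phases `e(−jn/8)` -/

/-- `(ζ₈^{cj})⁻¹·e(−jn/8) = ζ₈^{(8 − (c+n)j % 8) % 8}` (`ζ₈ = e(1/8)`). [folklore] -/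
theorem classWeight_mul_translatePhase (c n j : ℕ) :
    (cexp (2 * π * I / 8) ^ (c * j))⁻¹ * cexp (-(2 * π * I * ((j * n : ℕ) : ℂ) / 8)) =
      cexp (2 * π * I / 8) ^ ((8 - (c + n) * j % 8) % 8) := by
  have hA : (cexp (2 * π * I / 8) ^ (c * j))⁻¹ = cexp (2 * π * I / 8) ^ ((8 - c * j % 8) % 8) := by
    rw [← exp_neg_two_pi_I_mul_div_eight (c * j), ← exp_two_pi_I_mul_div_eight (c * j), ← Complex.exp_neg]
  have hB : cexp (-(2 * π * I * ((j * n : ℕ) : ℂ) / 8)) = cexp (2 * π * I / 8) ^ ((8 - j * n % 8) % 8) :=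
    exp_neg_two_pi_I_mul_div_eight (j * n)
  rw [hA, hB, ← pow_add, exp_two_pi_I_div_eight_pow_mod ((8 - c * j % 8) % 8 + (8 - j * n % 8) % 8)]
  congr 1
  have e : (c + n) * j = c * j + j * n := by ring
  rw [e]
  omega

end Summit.BirchSwinnertonDyer.BirchSwinnertonDyer.Theorems.PrintCFram.FlipRung

end
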